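import Summits.AtomisticToContinuum.BoseEinsteinCondensation.Theorems.BECCellInformationOneBodyEntropyBoundFVBridge
import HarnessLib

/-!
# Crux `OneBodyEntropyBound` — line `registered`, stub `stub_firstVariation`, part 2: the first variation

Support file (`--supports stmt-AtomisticToContinuum-13440`). **The approximate ground-state representation for a
near-minimiser.** Let `Φ` be an `n`-boson Dirichlet trial state in `Λ_L` with `energy v Φ ≤ E₀ + δ'` (`E₀ =
groundStateEnergy v n L < ∞`, `δ' < ∞`) and let `G` be a real permutation-symmetric `C¹` function on configuration
space with `0 ≤ G ≤ 1` and `‖∇G‖ ≤ D`. Then `𝓔[Gψ] ≤ E₀ ∫ G²|ψ|² + ∫ |∇G|²|ψ|² + √(δ' · (3(E₀ + δ') + 18 n D²))`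
(`stub_firstVariation`; for an exact ground state, `δ' = 0`, this is the identity `𝓔[Gψ] = E₀‖Gψ‖² + ∫|∇G|²|ψ|²`
behind every Jastrow-type upper bound, here in inequality form).

Proof (`FirstVariation.firstVariation`). With the real densities `ρ = |ψ|²`, `K = |∇ψ|²`, `u = V|ψ|²`, `g = |∇G|²` and
the cross density `c = Σ ∂G·⟨ψ, ∂ψ⟩`, the energy density of `(1 + tG²)ψ` minus `E₀` times its mass density is `f₀ + 2t
f₁ + t² f₂` with `f₀ = K + u − eρ`, `f₁ = G²(K+u) + 2Gc − eG²ρ`, `f₂ = 4G²gρ + G⁴(K+u) + 4G³c − eG⁴ρ` (part 1,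
`toReal_density_real_mul`). The variational principle for the symmetric `C¹` Dirichlet function `(1 + tG²)ψ` (part 1,
`groundStateEnergy_toReal_mul_le`) gives `0 ≤ ∫f₀ + 2t∫f₁ + t²∫f₂` for every real `t`, where `∫f₀ = energy − E₀ ≤ δ'`
and `∫f₂ ≤ 3 energy + 18nD²` (`|c| ≤ (gρ + K)/2`, `g ≤ 3nD²`, `0 ≤ G ≤ 1`); the extremal lemma yields `∫f₁ ≤
√(δ'(3(E₀+δ') + 18nD²))`, and `𝓔[Gψ] = ∫gρ + E₀∫G²ρ + ∫f₁` (part 1 with `H = G`). Everything is then moved back to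
`ℝ≥0∞`.
-/

noncomputable section

namespace Summit.AtomisticToContinuum.BoseEinsteinCondensation.Cruxes.OneBodyEntropyBound.Birth

namespace FirstVariation

open MeasureTheory Filter Topology
open scoped ENNReal NNReal
open Literature.MathematicalPhysics.QuantumManyBody.BoseGas

variable {n : ℕ} {L : ℝ} {v : ℝ → ℝ≥0∞}

/-! ### The first variation at a near-minimiser -/

/-- **First variation (approximate ground-state representation) at a near-minimiser, real form assembled in `ℝ≥0∞`.**
For an `n`-boson Dirichlet trial state `Φ` with `energy Φ ≤ E₀ + δ'` and a real symmetric `C¹` multiplier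
`0 ≤ G ≤ 1` with `‖∇G‖ ≤ D`:
`𝓔[Gψ] ≤ E₀ ∫ G²|ψ|² + ∫ |∇G|²|ψ|² + √(δ' (3(E₀ + δ') + 18 n D²))`.
Proof: expand the energy and mass of `(1 + tG²)ψ` in `t`, apply the variational principle for every real `t`
(`groundStateEnergy_toReal_mul_le`), and extremise the resulting nonnegative quadratic
(`le_sqrt_of_quadratic_nonneg`); the `t`-coefficient is `𝓔[Gψ] − E₀∫G²|ψ|² − ∫|∇G|²|ψ|²` and the `t²`-coefficient is
at most `3 energy Φ + 18 n D²` (`FVCalc.abs_cross_le`, `FVCalc.sum_sq_fderiv_le`). [folklore] -/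
theorem firstVariation (Φ : TrialState n L) (hv : Measurable v) {δ' : ℝ≥0∞} (hδ : δ' ≠ ⊤)
    (hE0 : groundStateEnergy v n L ≠ ⊤) (hΦ : energy v Φ ≤ groundStateEnergy v n L + δ')
    {G : Config n → ℝ} (hG : ContDiff ℝ 1 G) (hG01 : ∀ X, 0 ≤ G X ∧ G X ≤ 1)
    (hGsymm : ∀ (σ : Equiv.Perm (Fin n)) (X : Config n), G (X ∘ σ) = G X) {D : ℝ}
    (hD : ∀ X, ‖fderiv ℝ G X‖ ≤ D) :
    (∫⁻ X, (kineticDensity (fun X : Config n => (G X : ℂ) * Φ.ψ X) X +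
        interaction v X * ((‖(G X : ℂ) * Φ.ψ X‖₊ : ℝ≥0∞)) ^ 2)) ≤
      groundStateEnergy v n L * (∫⁻ X, ENNReal.ofReal (G X ^ 2) * ((‖Φ.ψ X‖₊ : ℝ≥0∞)) ^ 2) +
        (∫⁻ X, (∑ i : Fin n, ∑ k : Fin 3, ENNReal.ofReal ((fderiv ℝ G X (Pi.single i (EuclideanSpace.single k (1 : ℝ)))) ^ 2)) *
          ((‖Φ.ψ X‖₊ : ℝ≥0∞)) ^ 2) +
        ENNReal.ofReal (Real.sqrt (δ'.toReal *
          (3 * ((groundStateEnergy v n L).toReal + δ'.toReal) + 18 * n * D ^ 2))) := by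
  -- real scalars
  have hEδ : groundStateEnergy v n L + δ' ≠ ⊤ := ENNReal.add_ne_top.2 ⟨hE0, hδ⟩
  have hEfin : energy v Φ ≠ ⊤ := ne_top_of_le_ne_top hEδ hΦ
  set E₀ := groundStateEnergy v n L with hE₀
  set e := E₀.toReal with he
  set d := δ'.toReal with hd
  have he0 : 0 ≤ e := ENNReal.toReal_nonneg
  have hd0 : 0 ≤ d := ENNReal.toReal_nonneg
  have ha0 : (energy v Φ).toReal ≤ e + d := by
    rw [he, hd, ← ENNReal.toReal_add hE0 hδ]; exact ENNReal.toReal_mono hEδ hΦ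
  have hD0 : 0 ≤ D := (norm_nonneg _).trans (hD fun _ => 0)
  -- the densities `ρ = |ψ|²`, `K = |∇ψ|²`, `u = V|ψ|²`, `g = |∇G|²`, `c = Σ ∂G⟨ψ, ∂ψ⟩`
  set ψ := Φ.ψ with hψ
  set ρ : Config n → ℝ := fun X => ‖ψ X‖ ^ 2 with hρ
  set K : Config n → ℝ := fun X => (kineticDensity ψ X).toReal with hK
  set u : Config n → ℝ := fun X => (interaction v X * ((‖ψ X‖₊ : ℝ≥0∞)) ^ 2).toReal with hu
  set g : Config n → ℝ := fun X => ∑ i : Fin n, ∑ k : Fin 3,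
    (fderiv ℝ G X (Pi.single i (EuclideanSpace.single k (1 : ℝ)))) ^ 2 with hg
  set c : Config n → ℝ := fun X => ∑ i : Fin n, ∑ k : Fin 3,
    fderiv ℝ G X (Pi.single i (EuclideanSpace.single k (1 : ℝ))) *
      inner ℝ (ψ X) (fderiv ℝ ψ X (Pi.single i (EuclideanSpace.single k (1 : ℝ)))) with hc
  have hGd : Differentiable ℝ G := hG.differentiable one_ne_zero
  have hGc : Continuous G := hG.continuous
  have hG1 : ∀ X, |G X| ≤ 1 := fun X => abs_le.2 ⟨by linarith [(hG01 X).1], (hG01 X).2⟩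
  have hGp1 : ∀ (X) (j : ℕ), |G X ^ j| ≤ 1 := fun X j => by
    rw [abs_pow]; exact pow_le_one₀ (abs_nonneg _) (hG1 X)
  have hg0 : ∀ X, 0 ≤ g X := fun X => Finset.sum_nonneg fun i _ => Finset.sum_nonneg fun k _ => sq_nonneg _
  have hgD : ∀ X, g X ≤ 3 * n * D ^ 2 := fun X => FVCalc.sum_sq_fderiv_le hD X
  have hgb : ∀ X, |g X| ≤ 3 * n * D ^ 2 := fun X => by rw [abs_of_nonneg (hg0 X)]; exact hgD X
  have hgc : Continuous g := continuous_gradSq hG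
  have hρ0 : ∀ X, 0 ≤ ρ X := fun X => sq_nonneg _
  have hK0 : ∀ X, 0 ≤ K X := fun X => ENNReal.toReal_nonneg
  have hu0 : ∀ X, 0 ≤ u X := fun X => ENNReal.toReal_nonneg
  have hcb : ∀ X, |c X| ≤ (g X * ρ X + K X) / 2 := fun X => FVCalc.abs_cross_le G ψ X
  -- integrability
  have iρ : Integrable ρ := integrable_normSq Φ
  have iK : Integrable K := integrable_toReal_kineticDensity Φ hEfin
  have iu : Integrable u := integrable_toReal_interaction_normSq Φ hv hEfin
  have iKu : Integrable fun X => K X + u X := iK.add iu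
  have ic : Integrable c := integrable_cross hG hD Φ hEfin
  have igρ : Integrable fun X => g X * ρ X := integrable_bdd_mul iρ hgc hgb
  have iG2Ku : Integrable fun X => G X ^ 2 * (K X + u X) := integrable_bdd_mul iKu (hGc.pow 2) (fun X => hGp1 X 2)
  have iG4Ku : Integrable fun X => G X ^ 4 * (K X + u X) := integrable_bdd_mul iKu (hGc.pow 4) (fun X => hGp1 X 4)
  have iGc : Integrable fun X => G X * c X := integrable_bdd_mul ic hGc hG1
  have iG3c : Integrable fun X => G X ^ 3 * c X := integrable_bdd_mul ic (hGc.pow 3) (fun X => hGp1 X 3)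
  have iG2ρ : Integrable fun X => G X ^ 2 * ρ X := integrable_bdd_mul iρ (hGc.pow 2) (fun X => hGp1 X 2)
  have iG4ρ : Integrable fun X => G X ^ 4 * ρ X := integrable_bdd_mul iρ (hGc.pow 4) (fun X => hGp1 X 4)
  have iG2gρ : Integrable fun X => G X ^ 2 * (g X * ρ X) :=
    integrable_bdd_mul igρ (hGc.pow 2) (fun X => hGp1 X 2)
  -- the basic integrals
  have Iρ : ∫ X, ρ X = 1 := integral_normSq Φ
  have IKu : ∫ X, (K X + u X) = (energy v Φ).toReal := integral_energyDensity Φ hv hEfin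
  -- the coefficient densities of the expansion of the energy of `(1 + tG²)ψ` in `t`
  set f₀ : Config n → ℝ := fun X => K X + u X - e * ρ X with hf₀
  set f₁ : Config n → ℝ := fun X => G X ^ 2 * (K X + u X) + 2 * (G X * c X) - e * (G X ^ 2 * ρ X) with hf₁
  set f₂ : Config n → ℝ := fun X => 4 * (G X ^ 2 * (g X * ρ X)) + G X ^ 4 * (K X + u X) +
    4 * (G X ^ 3 * c X) - e * (G X ^ 4 * ρ X) with hf₂
  have iρe : Integrable fun X => e * ρ X := iρ.const_mul e
  have iGc2 : Integrable fun X => 2 * (G X * c X) := iGc.const_mul 2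
  have iA : Integrable fun X => G X ^ 2 * (K X + u X) + 2 * (G X * c X) := iG2Ku.add iGc2
  have iB : Integrable fun X => e * (G X ^ 2 * ρ X) := iG2ρ.const_mul e
  have if0 : Integrable f₀ := iKu.sub iρe
  have if1 : Integrable f₁ := iA.sub iB
  have if2 : Integrable f₂ :=
    (((iG2gρ.const_mul 4).add iG4Ku).add (iG3c.const_mul 4)).sub (iG4ρ.const_mul e)
  have If0 : ∫ X, f₀ X = (energy v Φ).toReal - e := by
    simp only [hf₀]
    rw [integral_sub iKu iρe, integral_const_mul, IKu, Iρ, mul_one]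
  set β₁ := ∫ X, f₁ X with hβ₁
  set β₂ := ∫ X, f₂ X with hβ₂
  have Iβ₁ : β₁ = (∫ X, G X ^ 2 * (K X + u X)) + 2 * (∫ X, G X * c X) - e * (∫ X, G X ^ 2 * ρ X) := by
    simp only [hβ₁, hf₁]
    rw [integral_sub iA iB, integral_add iG2Ku iGc2, integral_const_mul, integral_const_mul]
  -- Step 1: the variational inequality for `(1 + tG²)ψ`, for every real `t`
  have hquad : ∀ t : ℝ, 0 ≤ d + 2 * t * β₁ + t ^ 2 * β₂ := by
    intro t
    have hH : ContDiff ℝ 1 fun X => 1 + t * (G X * G X) :=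
      contDiff_const.add (contDiff_const.mul (hG.mul hG))
    have hq : ∀ X V, fderiv ℝ (fun X => 1 + t * (G X * G X)) X V = (2 * t * G X) * fderiv ℝ G X V := by
      intro X V
      have h1 : HasFDerivAt (fun Y => 1 + t * (G Y * G Y))
          (t • (G X • fderiv ℝ G X + G X • fderiv ℝ G X)) X :=
        (((hGd X).hasFDerivAt.mul (hGd X).hasFDerivAt).const_mul t).const_add (1 : ℝ)
      rw [h1.fderiv]
      simp only [smul_add, add_apply, smul_apply, smul_eq_mul]
      ring
    have hHs : ∀ (σ : Equiv.Perm (Fin n)) (X : Config n),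
        (fun X => 1 + t * (G X * G X)) (X ∘ σ) = (fun X => 1 + t * (G X * G X)) X := fun σ X => by
      simp only [hGsymm]
    have hHb : ∀ X, |(fun X => 1 + t * (G X * G X)) X| ≤ 1 + |t| := fun X => by
      have h1 : |G X * G X| ≤ 1 := by
        rw [abs_mul]; nlinarith [hG1 X, abs_nonneg (G X)]
      calc |1 + t * (G X * G X)| ≤ |(1 : ℝ)| + |t * (G X * G X)| := abs_add_le _ _
        _ ≤ 1 + |t| := by
          rw [abs_one, abs_mul]; nlinarith [abs_nonneg t]
    have iHρ : Integrable fun X => (1 + t * (G X * G X)) ^ 2 * ρ X :=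
      integrable_bdd_mul iρ ((continuous_const.add (continuous_const.mul (hGc.mul hGc))).pow 2)
        (C := (1 + |t|) ^ 2) fun X => by rw [abs_pow]; exact pow_le_pow_left₀ (abs_nonneg _) (hHb X) 2
    have if1t : Integrable fun X => 2 * t * f₁ X := if1.const_mul _
    have if2t : Integrable fun X => t ^ 2 * f₂ X := if2.const_mul _
    have i01 : Integrable fun X => f₀ X + 2 * t * f₁ X := if0.add if1t
    have i012 : Integrable fun X => f₀ X + 2 * t * f₁ X + t ^ 2 * f₂ X := i01.add if2t
    have iHe : Integrable fun X => e * ((1 + t * (G X * G X)) ^ 2 * ρ X) := iHρ.const_mul e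
    have iF : Integrable fun X => f₀ X + 2 * t * f₁ X + t ^ 2 * f₂ X + e * ((1 + t * (G X * G X)) ^ 2 * ρ X) :=
      i012.add iHe
    have hle := groundStateEnergy_toReal_mul_le Φ hv hEfin hH hq hHs hHb iF (fun X => by
      simp only [hf₀, hf₁, hf₂, hρ, hK, hu, hg, hc]; ring)
    rw [integral_add i012 iHe, integral_add i01 if2t, integral_add if0 if1t, integral_const_mul,
      integral_const_mul, integral_const_mul, If0] at hle
    have : (energy v Φ).toReal - e ≤ d := by linarith
    nlinarith [this]
  -- Step 2: the `t²`-coefficient is at most `3 energy Φ + 18 n D²`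
  have hβ₂ : β₂ ≤ 3 * (e + d) + 18 * n * D ^ 2 := by
    have hpt : ∀ X, f₂ X ≤ 18 * n * D ^ 2 * ρ X + 3 * (K X + u X) := by
      intro X
      simp only [hf₂]
      have hG0 := (hG01 X).1
      have hGle : ∀ j : ℕ, G X ^ j ≤ 1 := fun j => pow_le_one₀ hG0 (hG01 X).2
      have h1 : G X ^ 2 * (g X * ρ X) ≤ g X * ρ X :=
        mul_le_of_le_one_left (mul_nonneg (hg0 X) (hρ0 X)) (hGle 2)
      have h2 : G X ^ 4 * (K X + u X) ≤ K X + u X :=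
        mul_le_of_le_one_left (add_nonneg (hK0 X) (hu0 X)) (hGle 4)
      have h3 : G X ^ 3 * c X ≤ |c X| := by
        calc G X ^ 3 * c X ≤ |G X ^ 3 * c X| := le_abs_self _
          _ = G X ^ 3 * |c X| := by rw [abs_mul, abs_of_nonneg (pow_nonneg hG0 3)]
          _ ≤ |c X| := mul_le_of_le_one_left (abs_nonneg _) (hGle 3)
      have h4 : 0 ≤ e * (G X ^ 4 * ρ X) := mul_nonneg he0 (mul_nonneg (pow_nonneg hG0 4) (hρ0 X))
      have h5 := hcb X
      have h6 : g X * ρ X ≤ 3 * n * D ^ 2 * ρ X := mul_le_mul_of_nonneg_right (hgD X) (hρ0 X)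
      have h7 := hu0 X
      have h8 := hK0 X
      linarith
    have ibd : Integrable fun X => 18 * n * D ^ 2 * ρ X + 3 * (K X + u X) :=
      (iρ.const_mul _).add (iKu.const_mul 3)
    calc β₂ ≤ ∫ X, (18 * n * D ^ 2 * ρ X + 3 * (K X + u X)) := integral_mono if2 ibd hpt
      _ = 18 * n * D ^ 2 + 3 * (energy v Φ).toReal := by
          rw [integral_add (iρ.const_mul _) (iKu.const_mul 3), integral_const_mul, integral_const_mul, Iρ,
            IKu, mul_one]
      _ ≤ 3 * (e + d) + 18 * n * D ^ 2 := by linarith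
  -- Step 3: extremise
  have hβ₁ : β₁ ≤ Real.sqrt (d * (3 * (e + d) + 18 * n * D ^ 2)) := by
    refine (le_sqrt_of_quadratic_nonneg hd0 hquad).trans (Real.sqrt_le_sqrt ?_)
    exact mul_le_mul_of_nonneg_left (max_le hβ₂ (by positivity)) hd0
  -- Step 4: the energy of `Gψ` in real terms
  have hq1 : ∀ X V, fderiv ℝ G X V = (1 : ℝ) * fderiv ℝ G X V := fun X V => (one_mul _).symm
  have iC : Integrable fun X => g X * ρ X + G X ^ 2 * (K X + u X) := igρ.add iG2Ku
  have iL : Integrable fun X => g X * ρ X + G X ^ 2 * (K X + u X) + 2 * (G X * c X) := iC.add iGc2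
  have hL := lintegral_density_real_mul_eq Φ hv hEfin hG hq1 iL (fun X => by
    simp only [hρ, hK, hu, hg, hc]; ring)
  have IL : ∫ X, (g X * ρ X + G X ^ 2 * (K X + u X) + 2 * (G X * c X)) =
      (∫ X, g X * ρ X) + e * (∫ X, G X ^ 2 * ρ X) + β₁ := by
    rw [integral_add iC iGc2, integral_add igρ iG2Ku, integral_const_mul, Iβ₁]
    ring
  -- the two reference integrals in `ℝ≥0∞`
  have hW : (∫⁻ X, (∑ i : Fin n, ∑ k : Fin 3,
      ENNReal.ofReal ((fderiv ℝ G X (Pi.single i (EuclideanSpace.single k (1 : ℝ)))) ^ 2)) *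
      ((‖Φ.ψ X‖₊ : ℝ≥0∞)) ^ 2) = ENNReal.ofReal (∫ X, g X * ρ X) := by
    refine lintegral_eq_ofReal_integral (ae_of_all _ fun X => ENNReal.mul_ne_top ?_
      (ENNReal.pow_ne_top ENNReal.coe_ne_top)) igρ (ae_of_all _ fun X => ?_)
    · exact ENNReal.sum_ne_top.2 fun i _ => ENNReal.sum_ne_top.2 fun k _ => ENNReal.ofReal_ne_top
    · simp only [hg, hρ]
      rw [ENNReal.toReal_mul, coe_nnnorm_pow_two_eq_ofReal, ENNReal.toReal_ofReal (sq_nonneg _),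
        ENNReal.toReal_sum (fun i _ => ENNReal.sum_ne_top.2 fun k _ => ENNReal.ofReal_ne_top)]
      congr 1
      refine Finset.sum_congr rfl fun i _ => ?_
      rw [ENNReal.toReal_sum (fun k _ => ENNReal.ofReal_ne_top)]
      exact Finset.sum_congr rfl fun k _ => ENNReal.toReal_ofReal (sq_nonneg _)
  have hM : (∫⁻ X, ENNReal.ofReal (G X ^ 2) * ((‖Φ.ψ X‖₊ : ℝ≥0∞)) ^ 2) =
      ENNReal.ofReal (∫ X, G X ^ 2 * ρ X) := by
    refine lintegral_eq_ofReal_integral (ae_of_all _ fun X => ENNReal.mul_ne_top ENNReal.ofReal_ne_top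
      (ENNReal.pow_ne_top ENNReal.coe_ne_top)) iG2ρ (ae_of_all _ fun X => ?_)
    simp only [hρ]
    rw [ENNReal.toReal_mul, coe_nnnorm_pow_two_eq_ofReal, ENNReal.toReal_ofReal (sq_nonneg _),
      ENNReal.toReal_ofReal (sq_nonneg _)]
  have hW0 : 0 ≤ ∫ X, g X * ρ X := integral_nonneg fun X => mul_nonneg (hg0 X) (hρ0 X)
  have hM0 : 0 ≤ ∫ X, G X ^ 2 * ρ X := integral_nonneg fun X => mul_nonneg (sq_nonneg _) (hρ0 X)
  have hs0 : 0 ≤ Real.sqrt (d * (3 * (e + d) + 18 * n * D ^ 2)) := Real.sqrt_nonneg _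
  -- conclusion
  calc (∫⁻ X, (kineticDensity (fun X : Config n => (G X : ℂ) * Φ.ψ X) X +
        interaction v X * ((‖(G X : ℂ) * Φ.ψ X‖₊ : ℝ≥0∞)) ^ 2))
      = ENNReal.ofReal (∫ X, (g X * ρ X + G X ^ 2 * (K X + u X) + 2 * (G X * c X))) := hL
    _ ≤ ENNReal.ofReal (e * (∫ X, G X ^ 2 * ρ X) + (∫ X, g X * ρ X) +
          Real.sqrt (d * (3 * (e + d) + 18 * n * D ^ 2))) := by
        refine ENNReal.ofReal_le_ofReal ?_
        rw [IL]
        linarith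
    _ = E₀ * ENNReal.ofReal (∫ X, G X ^ 2 * ρ X) + ENNReal.ofReal (∫ X, g X * ρ X) +
          ENNReal.ofReal (Real.sqrt (d * (3 * (e + d) + 18 * n * D ^ 2))) := by
        rw [ENNReal.ofReal_add (add_nonneg (mul_nonneg he0 hM0) hW0) hs0,
          ENNReal.ofReal_add (mul_nonneg he0 hM0) hW0, ENNReal.ofReal_mul he0, he, ENNReal.ofReal_toReal hE0]
    _ = _ := by rw [hM, hW]

end FirstVariation

/-- **Stub `stub_firstVariation`** (first variation / approximate ground-state representation at a near-minimiser):
for an `n`-boson Dirichlet trial state `Φ` with `energy v Φ ≤ E₀(n,L) + δ'` (`E₀, δ' < ∞`) and every real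
permutation-symmetric `C¹` multiplier `0 ≤ G ≤ 1` with `‖∇G‖ ≤ D`,
`𝓔[GΦ] ≤ E₀ ∫ G²|Φ|² + ∫ |∇G|²|Φ|² + √(δ' · (3 (E₀ + δ') + 18 n D²))`
(`FirstVariation.firstVariation`). [folklore] -/
theorem stub_firstVariation :
    ∀ (n : ℕ) (L : ℝ) (v : ℝ → ENNReal), Measurable v →
      ∀ (Φ : Literature.MathematicalPhysics.QuantumManyBody.BoseGas.TrialState n L) (δ' : ENNReal), δ' ≠ ⊤ →
      Literature.MathematicalPhysics.QuantumManyBody.BoseGas.groundStateEnergy v n L ≠ ⊤ →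
      Literature.MathematicalPhysics.QuantumManyBody.BoseGas.energy v Φ ≤
        Literature.MathematicalPhysics.QuantumManyBody.BoseGas.groundStateEnergy v n L + δ' →
      ∀ (G : Literature.MathematicalPhysics.QuantumManyBody.BoseGas.Config n → ℝ), ContDiff ℝ 1 G →
      (∀ X, 0 ≤ G X ∧ G X ≤ 1) →
      (∀ (σ : Equiv.Perm (Fin n)) (X : Literature.MathematicalPhysics.QuantumManyBody.BoseGas.Config n),
        G (X ∘ σ) = G X) →
      ∀ (D : ℝ), (∀ X, ‖fderiv ℝ G X‖ ≤ D) →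
      (∫⁻ X, (Literature.MathematicalPhysics.QuantumManyBody.BoseGas.kineticDensity
          (fun X : Literature.MathematicalPhysics.QuantumManyBody.BoseGas.Config n => (G X : ℂ) * Φ.ψ X) X +
        Literature.MathematicalPhysics.QuantumManyBody.BoseGas.interaction v X *
          (‖(G X : ℂ) * Φ.ψ X‖₊ : ENNReal) ^ 2)) ≤
      Literature.MathematicalPhysics.QuantumManyBody.BoseGas.groundStateEnergy v n L *
          (∫⁻ X, ENNReal.ofReal (G X ^ 2) * (‖Φ.ψ X‖₊ : ENNReal) ^ 2) +
        (∫⁻ X, (∑ i : Fin n, ∑ k : Fin 3, ENNReal.ofReal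
            ((fderiv ℝ G X (Pi.single i (EuclideanSpace.single k (1 : ℝ)))) ^ 2)) * (‖Φ.ψ X‖₊ : ENNReal) ^ 2) +
        ENNReal.ofReal (Real.sqrt (δ'.toReal *
          (3 * ((Literature.MathematicalPhysics.QuantumManyBody.BoseGas.groundStateEnergy v n L).toReal + δ'.toReal) +
            18 * n * D ^ 2))) :=
  fun _n _L _v hv Φ _δ' hδ hE0 hΦ _G hG hG01 hGsymm _D hD =>
    FirstVariation.firstVariation Φ hv hδ hE0 hΦ hG hG01 hGsymm hD

end Summit.AtomisticToContinuum.BoseEinsteinCondensation.Cruxes.OneBodyEntropyBound.Birth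

end
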